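import Literature.Analysis.FluidPDE.SelfSimilarEulerProfileVorticity
import Literature.Analysis.FluidPDE.TaoEnstrophyLocalisationProofs
import Literature.Analysis.FluidPDE.PressurePoisson
import HarnessLib

/-!
# The pressure of a self-similar Euler profile solves `ΔP = −tr((DU)²) = |curl U|² − |DU|²`

Analysis/FluidPDE proofs file (theorems only), companion of `SelfSimilarEulerProfile.lean` /
`SelfSimilarEulerProfileVorticity.lean`.  Constantin–Ignatova–Vicol (arXiv:2602.17570, §3.1.1) write the
stationary self-similar Euler equation in velocity form (3.3), `(1−γ)U + ((γ(y−c) + U)·∇)U + ∇P = 0`,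
`∇·U = 0`.  Taking the DIVERGENCE of (3.3) — exactly as for the Euler/Navier–Stokes pressure, where
`−Δp = ∂ᵢ∂ⱼ(uᵢuⱼ) = tr((∇u)²)` (Majda–Bertozzi §1.8, (1.88)) — gives the POINTWISE Poisson equation of the
profile pressure (the tree already has `P ∈ C²`, `IsSelfSimilarEulerProfile.contDiff_two_pressure`):

* `IsSelfSimilarEulerProfile.divergence_transportTerm`: `div ((γ(y−c)+U)·∇ U) = tr (DU ∘ DU)` for a div-free
  `C²` field (the terms `γ div U`, `γ (y−c)·∇ div U − ...`, `U·∇ div U` vanish by `div U = 0` and the symmetry of `D²U`);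
* `IsSelfSimilarEulerProfile.laplacian_pressure_eq_neg_trace`: **`ΔP = −tr (DU ∘ DU)`** on a general
  finite-dimensional inner product space;
* on `ℝ³`: `IsSelfSimilarEulerProfile.laplacian_pressure_eq_sq_norm_curl_sub` — **`ΔP = |curl U|² − |DU|²_F`**
  (the pointwise algebra `|L|²_F = |curl L|² + tr(L²)`, `frobeniusNormSq_fderiv_eq_sq_norm_curl_add_trace`), hence
  the one-sided bounds `−|DU|²_F ≤ ΔP` (`neg_frobeniusNormSq_fderiv_le_laplacian_pressure`) and
  `−3‖DU‖² ≤ ΔP` (`neg_three_mul_sq_opNorm_fderiv_le_laplacian_pressure`, operator norm): the profile pressure is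
  SUBHARMONIC UP TO THE ENSTROPHY DENSITY — the input of the sub-mean-value inequality
  (`FluidPDE/SubMeanValue`) for pressurised points of class profiles.

NOT here: the weak/distributional Poisson equation for non-smooth profiles (see the Summits-side
`…SelfSimilarEndpointProfilePoisson`), Riesz-transform representations, decay of `P`.

## References

* P. Constantin, M. Ignatova, V. Vicol, *On putative self-similarity for incompressible 3D Euler*,
  arXiv:2602.17570 (2026), §3.1.1 eq. (3.3) [ConstantinIgnatovaVicol2026Putative].
* A. J. Majda, A. L. Bertozzi, *Vorticity and Incompressible Flow* (CUP 2002), §1.8 eq. (1.88)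
  (`−Δp = Σ ∂ᵢuⱼ ∂ⱼuᵢ`) [MajdaBertozziCUP2002].
-/

noncomputable section

open Set InnerProductSpace Function
open scoped RealInnerProductSpace Laplacian

namespace Literature.Analysis.FluidPDE

namespace IsSelfSimilarEulerProfile

section General

variable {E : Type*} [NormedAddCommGroup E] [InnerProductSpace ℝ E] [FiniteDimensional ℝ E]
variable {γ : ℝ} {c : E} {U : E → E} {P : E → ℝ}

/-- **The divergence of the transport term is the trace of `(DU)²`.**  For a `C²` divergence-free profile
velocity `U`, `div (y ↦ DU(y)[γ(y−c) + U(y)]) = tr (DU(y) ∘ DU(y))`: by the Leibniz rule the derivative of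
`y ↦ DU(y)[W(y)]`, `W = γ(y−c) + U`, is `DU ∘ DW + D²U(·, W)` with `DW = γ I + DU`; the trace of the first term is
`γ div U + tr (DU ∘ DU) = tr (DU ∘ DU)`, and the trace of the second is `D(div U)[W] = 0` by the symmetry of `D²U`.
[cite: ConstantinIgnatovaVicol2026Putative, §3.1.1 eq. (3.3)] -/
theorem divergence_transportTerm (h : IsSelfSimilarEulerProfile γ c U P) (y : E) :
    VectorCalculus.divergence (fun x => fderiv ℝ U x (γ • (x - c) + U x)) y =
      traceCLM ((fderiv ℝ U y).comp (fderiv ℝ U y)) := by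
  have hU2 : ContDiff ℝ 2 U := h.contDiff_velocity
  have hU1 : Differentiable ℝ U := h.differentiable_velocity
  have hDU : DifferentiableAt ℝ (fderiv ℝ U) y :=
    ((hU2.fderiv_right (m := 1) le_rfl).differentiable one_ne_zero) y
  have hWd : HasFDerivAt (fun x : E => γ • (x - c) + U x)
      (γ • ContinuousLinearMap.id ℝ E + fderiv ℝ U y) y :=
    (((hasFDerivAt_id y).sub_const c).fun_const_smul γ).fun_add (hU1 y).hasFDerivAt
  have hW : DifferentiableAt ℝ (fun x : E => γ • (x - c) + U x) y := hWd.differentiableAt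
  have hdiv0 : VectorCalculus.divergence U = fun _ => (0 : ℝ) := funext h.divFree
  -- the symmetric second-order term is `D(div U)[W] = 0`
  have hsymm : traceCLM ((fderiv ℝ (fderiv ℝ U) y).flip (γ • (y - c) + U y)) =
      fderiv ℝ (VectorCalculus.divergence U) y (γ • (y - c) + U y) := by
    rw [fderiv_divergence_apply hU2]
    congr 1
    ext u
    simp only [ContinuousLinearMap.flip_apply]
    exact (hU2.contDiffAt.isSymmSndFDerivAt (n := 2) (by simp)) u (γ • (y - c) + U y)
  rw [divergence_eq_traceCLM, fderiv_clm_apply hDU hW, hWd.fderiv, map_add, hsymm, hdiv0,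
    ContinuousLinearMap.comp_add, map_add, ContinuousLinearMap.comp_smul, map_smul,
    ContinuousLinearMap.comp_id, ← divergence_eq_traceCLM, hdiv0]
  simp

/-- **THE POISSON EQUATION OF THE PROFILE PRESSURE**: for a self-similar Euler profile `(U, P)` (velocity form
(3.3), `U ∈ C²`, `div U = 0`) on a finite-dimensional inner product space, `ΔP = −tr (DU ∘ DU)` pointwise — the
divergence of (3.3): `ΔP = div ∇P = −(1−γ) div U − div ((γ(y−c)+U)·∇ U) = −tr((DU)²)`.  (Twin of
`−Δp = Σᵢⱼ ∂ᵢuⱼ∂ⱼuᵢ` for Euler, Majda–Bertozzi (1.88).) [cite: ConstantinIgnatovaVicol2026Putative, §3.1.1 eq. (3.3)] -/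
theorem laplacian_pressure_eq_neg_trace (h : IsSelfSimilarEulerProfile γ c U P) (y : E) :
    (Δ P) y = -traceCLM ((fderiv ℝ U y).comp (fderiv ℝ U y)) := by
  have hU1 : Differentiable ℝ U := h.differentiable_velocity
  have hT : Differentiable ℝ (fun x => fderiv ℝ U x (γ • (x - c) + U x)) :=
    h.contDiff_one_transportTerm.differentiable one_ne_zero
  have hS : DifferentiableAt ℝ (fun x => (1 - γ) • U x) y := (hU1 y).const_smul (1 - γ)
  have h1 : traceCLM (fderiv ℝ (fun x => (1 - γ) • U x) y) = 0 := by
    rw [fderiv_fun_const_smul (hU1 y), map_smul, ← divergence_eq_traceCLM, h.divFree y, smul_zero]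
  have h2 : traceCLM (fderiv ℝ (fun x => fderiv ℝ U x (γ • (x - c) + U x)) y) =
      traceCLM ((fderiv ℝ U y).comp (fderiv ℝ U y)) := by
    rw [← divergence_eq_traceCLM, h.divergence_transportTerm y]
  rw [← divergence_gradient h.contDiff_two_pressure y, h.gradient_pressure_eq,
    divergence_eq_traceCLM, fderiv_fun_neg, map_neg, fderiv_fun_add hS (hT y), map_add,
    h1, h2, zero_add]

end General

/-! ### On `ℝ³`: `ΔP = |curl U|² − |DU|²_F`, so `P` is subharmonic up to the enstrophy density -/

variable {γ : ℝ} {c : EuclideanSpace ℝ (Fin 3)}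
variable {U : EuclideanSpace ℝ (Fin 3) → EuclideanSpace ℝ (Fin 3)} {P : EuclideanSpace ℝ (Fin 3) → ℝ}

/-- **`ΔP = |curl U|² − |DU|²_F` on `ℝ³`** for a self-similar Euler profile: the Poisson equation
`ΔP = −tr((DU)²)` and the pointwise algebra `|DU|²_F = |curl U|² + tr(DU ∘ DU)`
(`frobeniusNormSq_fderiv_eq_sq_norm_curl_add_trace`). [cite: ConstantinIgnatovaVicol2026Putative, §3.1.1 eq. (3.3)] -/
theorem laplacian_pressure_eq_sq_norm_curl_sub (h : IsSelfSimilarEulerProfile γ c U P)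
    (y : EuclideanSpace ℝ (Fin 3)) :
    (Δ P) y = ‖curl U y‖ ^ 2 - frobeniusNormSq (fderiv ℝ U y) := by
  rw [h.laplacian_pressure_eq_neg_trace, frobeniusNormSq_fderiv_eq_sq_norm_curl_add_trace]
  ring

/-- **The profile pressure is subharmonic up to the enstrophy density**: `−|DU(y)|²_F ≤ (ΔP)(y)` on `ℝ³`.
[cite: ConstantinIgnatovaVicol2026Putative, §3.1.1 eq. (3.3)] -/
theorem neg_frobeniusNormSq_fderiv_le_laplacian_pressure (h : IsSelfSimilarEulerProfile γ c U P)
    (y : EuclideanSpace ℝ (Fin 3)) :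
    -frobeniusNormSq (fderiv ℝ U y) ≤ (Δ P) y := by
  rw [h.laplacian_pressure_eq_sq_norm_curl_sub]
  nlinarith [sq_nonneg ‖curl U y‖]

/-- Operator-norm form: `−3‖DU(y)‖² ≤ (ΔP)(y)` on `ℝ³` (`|L|²_F ≤ 3‖L‖²`).
[cite: ConstantinIgnatovaVicol2026Putative, §3.1.1 eq. (3.3)] -/
theorem neg_three_mul_sq_opNorm_fderiv_le_laplacian_pressure (h : IsSelfSimilarEulerProfile γ c U P)
    (y : EuclideanSpace ℝ (Fin 3)) :
    -(3 * ‖fderiv ℝ U y‖ ^ 2) ≤ (Δ P) y := by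
  have hF := sum_sq_norm_apply_le_card_mul_sq_opNorm (EuclideanSpace.basisFun (Fin 3) ℝ) (fderiv ℝ U y)
  rw [← frobeniusNormSq_eq_sum, Fintype.card_fin] at hF
  have h3 : frobeniusNormSq (fderiv ℝ U y) ≤ 3 * ‖fderiv ℝ U y‖ ^ 2 := by exact_mod_cast hF
  linarith [h.neg_frobeniusNormSq_fderiv_le_laplacian_pressure y]

/-- `ΔP ≤ |curl U|²` on `ℝ³`: the profile pressure is superharmonic up to the enstrophy of the ROTATIONAL part;
in particular `P` is superharmonic (`ΔP ≤ 0`) wherever `curl U = 0`. [cite: ConstantinIgnatovaVicol2026Putative, §3.1.1 eq. (3.3)] -/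
theorem laplacian_pressure_le_sq_norm_curl (h : IsSelfSimilarEulerProfile γ c U P)
    (y : EuclideanSpace ℝ (Fin 3)) :
    (Δ P) y ≤ ‖curl U y‖ ^ 2 := by
  rw [h.laplacian_pressure_eq_sq_norm_curl_sub]
  linarith [frobeniusNormSq_nonneg (fderiv ℝ U y)]

end IsSelfSimilarEulerProfile

end Literature.Analysis.FluidPDE

end
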